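import Literature.Combinatorics.Additive.DeZeeuwLineIntersectionBound
import Literature.Combinatorics.Extremal.LinesThroughPointOfSurface
import HarnessLib

/-!
# A plane curve of degree `d` contains at most `d` lines

Topic `Literature/Combinatorics/Extremal` (the polynomial method in incidence geometry; a basic
tool of the Guth–Katz / Kollár theory of lines on surfaces — "no plane contains more than …
lines of the surface" is always reduced to this count on the plane section). PROVED.

* `card_lines_le_totalDegree` — over an infinite field `K`, if a nonzero `g ∈ K[X₀, X₁]`
  vanishes at every point of each line of a finite set `Λ` of (distinct) lines of `K²`, then
  `|Λ| ≤ deg g`.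
* `card_lines_in_plane_le_totalDegree` — the form in which it is used for surfaces: if
  `f ∈ K[X₀, X₁, X₂]` does not vanish identically on a plane `Π ⊆ K³`, then at most `deg f`
  lines contained in `Π` lie on `{f = 0}` (pull back along an affine parametrization of `Π`).
* `exists_mem_eval_ne_zero_of_irreducible` — an irreducible surface of degree `≥ 2` contains
  no plane (the plane's linear form would divide a translate of `f`,
  `Literature.Combinatorics.Extremal.linearForm_dvd_of_eval_eq_zero`).
* `card_lines_in_plane_le_of_irreducible` — hence a plane contains at most `d` lines of an
  irreducible surface of degree `d ≥ 2`: the count used (twice) in Kollár's proof of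
  Prop. 55.

The textbook proof ("each line contributes a linear factor") is replaced by a transversal
count that needs no unique factorisation: pick a point `z₀` with `g(z₀) ≠ 0` (so `z₀` lies on
no line of `Λ`) and a direction `e = (1, m)` that is parallel to no line of `Λ` and such that
the transversal `L₀ = {z₀ + s e}` avoids the pairwise intersections of the lines of `Λ` (each
of the two requirements excludes at most one slope `m` per line, resp. per pair); then
`ℓ ↦ L₀ ∩ ℓ` is injective into the zero set of the nonzero univariate polynomial `g(z₀ + s e)` of
degree `≤ deg g` (Bézout on a line, `Literature.Combinatorics.Extremal.card_filter_eval_line_eq_zero_le`).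

## References
* [Kollar2015] J. Kollár, Adv. Math. 271 (2015) 30–61 — §7, proof of Prop. 55 ("every other
  ruling meets `P` in 2 points, thus is contained in `P`, hence `S = P`"), where plane sections
  are counted this way. The statement itself is classical. [folklore]
-/

namespace Literature.Combinatorics.Extremal

open MvPolynomial Finset

section LinesParam

variable {K : Type*} [Field K] {V : Type*} [AddCommGroup V] [Module K V]

/-- A line (affine subspace with direction of rank `1`) of a vector space is `{u + t v}` for
some `u` and `v ≠ 0`. [folklore] -/
theorem exists_point_dir_of_finrank_eq_one (ℓ : AffineSubspace K V)
    (h : Module.finrank K ℓ.direction = 1) :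
    ∃ uv : V × V, uv.2 ≠ 0 ∧ (∀ z, z ∈ ℓ ↔ ∃ t : K, z = uv.1 + t • uv.2) ∧
      ℓ.direction = K ∙ uv.2 := by
  have hne : (ℓ : Set V).Nonempty := by
    rw [AffineSubspace.nonempty_iff_ne_bot]
    intro hbot
    rw [hbot, AffineSubspace.direction_bot, finrank_bot] at h
    omega
  obtain ⟨u, hu⟩ := hne
  obtain ⟨v, hv, hspan⟩ := finrank_eq_one_iff'.1 h
  have hdir : ℓ.direction = K ∙ (v : V) := by
    refine le_antisymm (fun x hx => ?_) ((Submodule.span_singleton_le_iff_mem _ _).2 v.2)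
    obtain ⟨c, hc⟩ := hspan ⟨x, hx⟩
    rw [Submodule.mem_span_singleton]
    exact ⟨c, by simpa [Subtype.ext_iff] using hc⟩
  refine ⟨(u, (v : V)), fun h0 => hv (Submodule.coe_eq_zero.mp h0), fun z => ?_, hdir⟩
  rw [← AffineSubspace.vsub_right_mem_direction_iff_mem hu z]
  constructor
  · intro hz
    obtain ⟨c, hc⟩ := hspan ⟨z -ᵥ u, hz⟩
    refine ⟨c, ?_⟩
    have := congrArg Subtype.val hc
    simp only [SetLike.val_smul] at this
    rw [vsub_eq_sub] at this
    simp only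
    rw [this]; abel
  · rintro ⟨t, rfl⟩
    have e : (u + t • (v : V)) -ᵥ u = t • (v : V) := by rw [vsub_eq_sub]; abel
    simp only at e ⊢
    rw [e]
    exact ℓ.direction.smul_mem t v.2

end LinesParam

section PlaneCurve

variable {K : Type*} [Field K]

/-- The transversal direction `(1, m)`. [folklore] -/
def dirm (m : K) : Fin 2 → K := ![1, m]

/-- First coordinate of the transversal direction. [folklore] -/
@[simp] theorem dirm_zero (m : K) : dirm m 0 = 1 := rfl

/-- Second coordinate of the transversal direction. [folklore] -/
@[simp] theorem dirm_one (m : K) : dirm m 1 = m := rfl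

/-- Two transversal directions through the same point hit a point in different places unless
the parameter vanishes: `s (1,m) = s' (1,m')`, `m ≠ m'` forces `s = 0`. [folklore] -/
theorem smul_dirm_eq_smul_dirm {m m' s s' : K} (hmm : m ≠ m') (h : s • dirm m = s' • dirm m') :
    s = 0 := by
  have h0 := congr_fun h 0
  have h1 := congr_fun h 1
  simp only [Pi.smul_apply, dirm_zero, dirm_one, smul_eq_mul, mul_one] at h0 h1
  rw [← h0] at h1
  have : s * (m - m') = 0 := by linear_combination h1
  exact (mul_eq_zero.1 this).resolve_right (sub_ne_zero.2 hmm)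

open scoped Classical in
/-- **A plane curve of degree `d` contains at most `d` lines** (infinite field; lines as affine
subspaces of `K²` with direction of rank `1`, containment pointwise). [folklore] -/
theorem card_lines_le_totalDegree [Infinite K] {g : MvPolynomial (Fin 2) K} (hg : g ≠ 0)
    (Λ : Finset (AffineSubspace K (Fin 2 → K)))
    (hΛ : ∀ ℓ ∈ Λ, Module.finrank K ℓ.direction = 1)
    (hvan : ∀ ℓ ∈ Λ, ∀ z ∈ ℓ, eval z g = 0) : Λ.card ≤ g.totalDegree := by
  -- a point off the curve, hence off every line of `Λ`
  obtain ⟨z₀, hz₀⟩ := Literature.Combinatorics.Additive.DeZeeuw.exists_eval_ne_zero hg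
  have hz₀ℓ : ∀ ℓ ∈ Λ, z₀ ∉ ℓ := fun ℓ hℓ h => hz₀ (hvan ℓ hℓ z₀ h)
  -- parametrizations
  have hpar := fun ℓ (hℓ : ℓ ∈ Λ) => exists_point_dir_of_finrank_eq_one ℓ (hΛ ℓ hℓ)
  choose! uv huv0 huv hdir using hpar
  -- bad slopes, (i): parallel to a line of `Λ`
  have hbad1 : ∀ ℓ ∈ Λ, ({m : K | dirm m ∈ ℓ.direction} : Set K).Subsingleton := by
    intro ℓ hℓ m hm m' hm'
    simp only [Set.mem_setOf_eq] at hm hm'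
    by_contra hne
    have hdiff : dirm m - dirm m' ∈ ℓ.direction := ℓ.direction.sub_mem hm hm'
    -- `dirm m - dirm m' = (0, m - m')` and `dirm m` span `K²`, but the direction has rank `1`
    rw [hdir ℓ hℓ, Submodule.mem_span_singleton] at hm hdiff
    obtain ⟨a, ha⟩ := hm
    obtain ⟨b, hb⟩ := hdiff
    have ha0 := congr_fun ha 0
    have ha1 := congr_fun ha 1
    have hb0 := congr_fun hb 0
    have hb1 := congr_fun hb 1
    simp only [Pi.smul_apply, smul_eq_mul, dirm_zero, dirm_one, Pi.sub_apply, sub_self] at ha0 ha1 hb0 hb1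
    -- from `hb0 : b * v₀ = 0`: `b = 0` or `v₀ = 0`
    rcases mul_eq_zero.1 hb0 with hb' | hv0
    · rw [hb', zero_mul] at hb1
      exact hne (sub_eq_zero.1 hb1.symm)
    · rw [hv0, mul_zero] at ha0
      exact one_ne_zero ha0.symm
  -- bad slopes, (ii): the transversal through `z₀` hits two lines of `Λ` at the same point
  have hbad2 : ∀ ℓ ∈ Λ, ∀ ℓ' ∈ Λ, ℓ ≠ ℓ' →
      ({m : K | ∃ s : K, z₀ + s • dirm m ∈ ℓ ∧ z₀ + s • dirm m ∈ ℓ'} : Set K).Subsingleton := by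
    intro ℓ hℓ ℓ' hℓ' hne m hm m' hm'
    by_contra hmm
    obtain ⟨s, hs, hs'⟩ := hm
    obtain ⟨s', ht, ht'⟩ := hm'
    -- the two points coincide (two distinct lines meet at most once) ...
    have heq : z₀ + s • dirm m = z₀ + s' • dirm m' := by
      by_contra hpts
      -- distinct common points force equal lines
      apply hne
      have hv : (z₀ + s' • dirm m') -ᵥ (z₀ + s • dirm m) ≠ 0 := fun h0 =>
        hpts (eq_of_vsub_eq_zero h0).symm
      have key : ∀ (L : AffineSubspace K (Fin 2 → K)), Module.finrank K L.direction = 1 →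
          z₀ + s • dirm m ∈ L → z₀ + s' • dirm m' ∈ L →
          L.direction = K ∙ ((z₀ + s' • dirm m') -ᵥ (z₀ + s • dirm m)) := by
        intro L hL h1 h2
        haveI : FiniteDimensional K L.direction := Module.finite_of_finrank_eq_succ hL
        refine (Submodule.eq_of_le_of_finrank_eq ((Submodule.span_singleton_le_iff_mem _ _).2
          (AffineSubspace.vsub_mem_direction h2 h1)) ?_).symm
        rw [finrank_span_singleton hv, hL]
      exact AffineSubspace.ext_of_direction_eq
        ((key ℓ (hΛ ℓ hℓ) hs ht).trans (key ℓ' (hΛ ℓ' hℓ') hs' ht').symm)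
        ⟨z₀ + s • dirm m, hs, hs'⟩
    -- ... hence `s = 0` and `z₀ ∈ ℓ`: impossible
    have hs0 : s = 0 := smul_dirm_eq_smul_dirm hmm (add_left_cancel heq)
    rw [hs0, zero_smul, add_zero] at hs
    exact hz₀ℓ ℓ hℓ hs
  -- a good slope
  obtain ⟨m, hm1, hm2⟩ : ∃ m : K, (∀ ℓ ∈ Λ, dirm m ∉ ℓ.direction) ∧
      ∀ ℓ ∈ Λ, ∀ ℓ' ∈ Λ, ℓ ≠ ℓ' → ¬ ∃ s : K, z₀ + s • dirm m ∈ ℓ ∧ z₀ + s • dirm m ∈ ℓ' := by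
    set B1 : Finset K := Λ.attach.biUnion fun ℓ =>
      ((hbad1 ℓ.1 ℓ.2).finite).toFinset with hB1
    set B2 : Finset K := (Λ ×ˢ Λ).attach.biUnion fun p =>
      if h : p.1.1 ≠ p.1.2 then ((hbad2 p.1.1 (mem_product.1 p.2).1 p.1.2
        (mem_product.1 p.2).2 h).finite).toFinset else ∅ with hB2
    obtain ⟨m, hm⟩ := Infinite.exists_notMem_finset (B1 ∪ B2)
    rw [mem_union, not_or] at hm
    refine ⟨m, fun ℓ hℓ hmem => hm.1 ?_, fun ℓ hℓ ℓ' hℓ' hne hex => hm.2 ?_⟩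
    · rw [hB1, mem_biUnion]
      exact ⟨⟨ℓ, hℓ⟩, mem_attach _ _, by simpa using hmem⟩
    · rw [hB2, mem_biUnion]
      refine ⟨⟨(ℓ, ℓ'), mem_product.2 ⟨hℓ, hℓ'⟩⟩, mem_attach _ _, ?_⟩
      simp only [ne_eq, hne, not_false_eq_true, dif_pos, Set.Finite.mem_toFinset, Set.mem_setOf_eq]
      exact hex
  -- the transversal `L₀ = {z₀ + s e}` meets every line of `Λ` exactly once
  set e := dirm m with he
  have hmeet : ∀ ℓ ∈ Λ, ∃ s : K, z₀ + s • e ∈ ℓ := by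
    intro ℓ hℓ
    -- non-parallel: `v₁ - m v₀ ≠ 0`
    have hδ : (uv ℓ).2 1 - m * (uv ℓ).2 0 ≠ 0 := by
      intro hδ
      apply hm1 ℓ hℓ
      rw [hdir ℓ hℓ, Submodule.mem_span_singleton]
      -- `v = v₀ • e` with `v₀ ≠ 0`
      have hv0 : (uv ℓ).2 0 ≠ 0 := by
        intro hv0
        apply huv0 ℓ hℓ
        funext i
        fin_cases i
        · exact hv0
        · rw [hv0, mul_zero, sub_zero] at hδ
          exact hδ
      refine ⟨((uv ℓ).2 0)⁻¹, ?_⟩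
      funext i
      fin_cases i
      · show ((uv ℓ).2 0)⁻¹ * (uv ℓ).2 0 = e 0
        rw [he, dirm_zero, inv_mul_cancel₀ hv0]
      · show ((uv ℓ).2 0)⁻¹ * (uv ℓ).2 1 = e 1
        rw [he, dirm_one]
        field_simp
        linear_combination hδ
    set t := (z₀ 1 - (uv ℓ).1 1 + m * ((uv ℓ).1 0 - z₀ 0)) / ((uv ℓ).2 1 - m * (uv ℓ).2 0)
      with ht
    refine ⟨(uv ℓ).1 0 + t * (uv ℓ).2 0 - z₀ 0, (huv ℓ hℓ _).2 ⟨t, ?_⟩⟩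
    funext i
    fin_cases i
    · show z₀ 0 + ((uv ℓ).1 0 + t * (uv ℓ).2 0 - z₀ 0) * e 0 = (uv ℓ).1 0 + t * (uv ℓ).2 0
      rw [he, dirm_zero]; ring
    · show z₀ 1 + ((uv ℓ).1 0 + t * (uv ℓ).2 0 - z₀ 0) * e 1 = (uv ℓ).1 1 + t * (uv ℓ).2 1
      rw [he, dirm_one, ht]
      field_simp
      ring
  choose! σ hσ using hmeet
  -- `σ` is injective on `Λ`
  have hinj : Set.InjOn σ Λ := by
    intro ℓ hℓ ℓ' hℓ' hs
    by_contra hne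
    exact hm2 ℓ hℓ ℓ' hℓ' hne ⟨σ ℓ, hσ ℓ hℓ, hs ▸ hσ ℓ' hℓ'⟩
  -- all `σ ℓ` are roots of `g(z₀ + s e)`, a nonzero polynomial of degree `≤ deg g`
  have hres : MvPolynomial.aeval
      (fun i => Polynomial.C (z₀ i) + Polynomial.C (e i) * Polynomial.X) g ≠ 0 := by
    intro h0
    have := eval_aeval_line z₀ e g 0
    rw [h0, Polynomial.eval_zero, zero_smul, add_zero] at this
    exact hz₀ this.symm
  rw [← card_image_of_injOn hinj]
  have hall : (Λ.image σ).filter (fun s => eval (z₀ + s • e) g = 0) = Λ.image σ := by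
    refine filter_true_of_mem fun s hs => ?_
    obtain ⟨ℓ, hℓ, rfl⟩ := mem_image.1 hs
    exact hvan ℓ hℓ _ (hσ ℓ hℓ)
  rw [← hall]
  exact card_filter_eval_line_eq_zero_le z₀ e g _ hres

end PlaneCurve

section PlaneSection

variable {K : Type*} [Field K]

open Literature.Combinatorics.Additive.DeZeeuw (exists_param)
open Literature.Computability.AlgebraicComplexity.DeterminantalConormal (eval_aeval_eq_eval)

/-- **A plane section of a surface of degree `d` contains at most `d` lines**: if `f` does not
vanish identically on the plane `Pl ⊆ K³` (`K` infinite), then at most `deg f` lines of `Pl` lie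
(pointwise) on `{f = 0}`. Reduced to `card_lines_le_totalDegree` by an affine parametrization
`w ↦ u + w₀ a + w₁ c` of `Pl`. [folklore] -/
theorem card_lines_in_plane_le_totalDegree [Infinite K] (f : MvPolynomial (Fin 3) K)
    (Pl : AffineSubspace K (Fin 3 → K)) (hPl : Module.finrank K Pl.direction = 2)
    (hfPl : ∃ z ∈ Pl, eval z f ≠ 0) (Λ : Finset (AffineSubspace K (Fin 3 → K)))
    (hΛ1 : ∀ ℓ ∈ Λ, Module.finrank K ℓ.direction = 1) (hΛPl : ∀ ℓ ∈ Λ, ℓ ≤ Pl)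
    (hvan : ∀ ℓ ∈ Λ, ∀ z ∈ ℓ, eval z f = 0) : Λ.card ≤ f.totalDegree := by
  classical
  obtain ⟨u, hu, hfu⟩ := hfPl
  -- a basis `a, c` of the direction of `Pl`
  haveI : FiniteDimensional K Pl.direction := Module.finite_of_finrank_eq_succ hPl
  set B := Module.finBasisOfFinrankEq K Pl.direction hPl with hB
  set a : Fin 3 → K := ((B 0 : Pl.direction) : Fin 3 → K) with ha
  set c : Fin 3 → K := ((B 1 : Pl.direction) : Fin 3 → K) with hc
  have hrepr : ∀ x : Fin 3 → K, x ∈ Pl.direction → ∃ r₀ r₁ : K, x = r₀ • a + r₁ • c := by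
    intro x hx
    refine ⟨B.repr ⟨x, hx⟩ 0, B.repr ⟨x, hx⟩ 1, ?_⟩
    have := congrArg Subtype.val (B.sum_repr ⟨x, hx⟩)
    rw [Fin.sum_univ_two] at this
    simpa [ha, hc] using this.symm
  -- the parametrization `φ(w) = u + w₀ a + w₁ c` and the pulled-back polynomial `g`
  set φ : (Fin 2 → K) → (Fin 3 → K) := fun w => u + w 0 • a + w 1 • c with hφ
  set g : MvPolynomial (Fin 2) K :=
    aeval (fun i => C (u i) + C (a i) * X 0 + C (c i) * X 1) f with hg
  have hgeval : ∀ w : Fin 2 → K, eval w g = eval (φ w) f := by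
    intro w
    rw [hg, eval_aeval_eq_eval]
    have : (fun i => eval w (C (u i) + C (a i) * X 0 + C (c i) * X 1)) = φ w := by
      funext i
      simp [hφ, mul_comm]
    rw [this]
  have hg0 : g ≠ 0 := by
    intro h0
    have := hgeval 0
    rw [h0, map_zero] at this
    simp only [hφ, Pi.zero_apply, zero_smul, add_zero] at this
    exact hfu this.symm
  have hgdeg : g.totalDegree ≤ f.totalDegree := by
    refine totalDegree_aeval_le_of_le_one _ (fun i => ?_) f
    refine (totalDegree_add _ _).trans (max_le ((totalDegree_add _ _).trans (max_le ?_ ?_)) ?_)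
    · rw [totalDegree_C]; exact Nat.zero_le _
    · exact (totalDegree_mul _ _).trans (by rw [totalDegree_C, totalDegree_X, zero_add])
    · exact (totalDegree_mul _ _).trans (by rw [totalDegree_C, totalDegree_X, zero_add])
  -- coordinates of the lines of `Λ` in the frame `(u; a, c)`
  have hcoord : ∀ ℓ ∈ Λ, ∃ q : K × K × K × K, (q.2.2.1, q.2.2.2) ≠ (0, 0) ∧
      ∀ z, z ∈ ℓ ↔ ∃ t : K, z = φ (![q.1, q.2.1] + t • ![q.2.2.1, q.2.2.2]) := by
    intro ℓ hℓ
    obtain ⟨pv, hv0, hmem⟩ := exists_param ℓ (hΛ1 ℓ hℓ)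
    have hp : pv.1 ∈ Pl := hΛPl ℓ hℓ ((hmem _).2 ⟨0, by simp⟩)
    have hp1 : pv.1 + (1 : K) • pv.2 ∈ Pl := hΛPl ℓ hℓ ((hmem _).2 ⟨1, rfl⟩)
    have hvdir : pv.2 ∈ Pl.direction := by
      have := AffineSubspace.vsub_mem_direction hp1 hp
      simpa [vsub_eq_sub] using this
    obtain ⟨r₀, r₁, hr⟩ := hrepr _ (AffineSubspace.vsub_mem_direction hp hu)
    obtain ⟨s₀, s₁, hs⟩ := hrepr _ hvdir
    refine ⟨(r₀, r₁, s₀, s₁), ?_, fun z => ?_⟩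
    · intro h0
      simp only [Prod.mk.injEq] at h0
      apply hv0
      rw [hs, h0.1, h0.2, zero_smul, zero_smul, add_zero]
    · rw [hmem z]
      have hpt : ∀ t : K, pv.1 + t • pv.2 = φ (![r₀, r₁] + t • ![s₀, s₁]) := by
        intro t
        have hp' : pv.1 = u + (r₀ • a + r₁ • c) := by
          rw [← hr, vsub_eq_sub, add_sub_cancel]
        rw [hp', hs, hφ]
        simp only [Pi.add_apply, Pi.smul_apply, Matrix.cons_val_zero, Matrix.cons_val_one,
          smul_eq_mul]
        module
      simp only [hpt]
  choose! q hq0 hq using hcoord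
  -- the pulled-back lines
  set pre : AffineSubspace K (Fin 3 → K) → AffineSubspace K (Fin 2 → K) := fun ℓ =>
    AffineSubspace.mk' ![(q ℓ).1, (q ℓ).2.1] (K ∙ ![(q ℓ).2.2.1, (q ℓ).2.2.2]) with hpre
  have hdir0 : ∀ ℓ ∈ Λ, (![(q ℓ).2.2.1, (q ℓ).2.2.2] : Fin 2 → K) ≠ 0 := by
    intro ℓ hℓ h0
    apply hq0 ℓ hℓ
    have h1 := congr_fun h0 0
    have h2 := congr_fun h0 1
    simp only [Matrix.cons_val_zero, Matrix.cons_val_one, Pi.zero_apply] at h1 h2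
    rw [h1, h2]
  have hmem_pre : ∀ ℓ w, w ∈ pre ℓ ↔ ∃ t : K,
      w = ![(q ℓ).1, (q ℓ).2.1] + t • ![(q ℓ).2.2.1, (q ℓ).2.2.2] := by
    intro ℓ w
    rw [hpre]
    simp only [AffineSubspace.mem_mk', Submodule.mem_span_singleton, vsub_eq_sub]
    constructor
    · rintro ⟨t, ht⟩
      exact ⟨t, by rw [ht]; abel⟩
    · rintro ⟨t, rfl⟩
      exact ⟨t, by abel⟩
  have hpre1 : ∀ ℓ ∈ Λ, Module.finrank K (pre ℓ).direction = 1 := by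
    intro ℓ hℓ
    rw [hpre, AffineSubspace.direction_mk']
    exact finrank_span_singleton (hdir0 ℓ hℓ)
  have hpre_van : ∀ ℓ ∈ Λ, ∀ w ∈ pre ℓ, eval w g = 0 := by
    intro ℓ hℓ w hw
    obtain ⟨t, rfl⟩ := (hmem_pre ℓ w).1 hw
    rw [hgeval]
    exact hvan ℓ hℓ _ ((hq ℓ hℓ _).2 ⟨t, rfl⟩)
  have hchar : ∀ ℓ ∈ Λ, ∀ z, z ∈ ℓ ↔ ∃ w ∈ pre ℓ, φ w = z := by
    intro ℓ hℓ z
    rw [hq ℓ hℓ z]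
    constructor
    · rintro ⟨t, rfl⟩
      exact ⟨_, (hmem_pre ℓ _).2 ⟨t, rfl⟩, rfl⟩
    · rintro ⟨w, hw, rfl⟩
      obtain ⟨t, rfl⟩ := (hmem_pre ℓ w).1 hw
      exact ⟨t, rfl⟩
  have hinj : Set.InjOn pre Λ := by
    intro ℓ hℓ ℓ' hℓ' h
    refine SetLike.ext fun z => ?_
    rw [hchar ℓ hℓ, hchar ℓ' hℓ', h]
  -- conclude on the plane
  rw [← card_image_of_injOn hinj]
  refine (card_lines_le_totalDegree hg0 (Λ.image pre) ?_ ?_).trans hgdeg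
  · simp only [mem_image]
    rintro _ ⟨ℓ, hℓ, rfl⟩
    exact hpre1 ℓ hℓ
  · simp only [mem_image]
    rintro _ ⟨ℓ, hℓ, rfl⟩
    exact hpre_van ℓ hℓ

end PlaneSection

section NoPlane

variable {K : Type*} [Field K]

open Literature.Combinatorics.Additive.DeZeeuw (exists_equation_of_finrank_eq_two)

/-- **An irreducible surface of degree `≥ 2` contains no plane**: if `f` is irreducible of total
degree `≥ 2` over an infinite field, then `f` does not vanish identically on any plane
`Pl ⊆ K³` — otherwise the plane's linear form divides (a translate of) `f`
(`linearForm_dvd_of_eval_eq_zero`). [folklore] -/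
theorem exists_mem_eval_ne_zero_of_irreducible [Infinite K] {f : MvPolynomial (Fin 3) K}
    (hf : Irreducible f) (hd : 2 ≤ f.totalDegree) (Pl : AffineSubspace K (Fin 3 → K))
    (hPl : Module.finrank K Pl.direction = 2) : ∃ z ∈ Pl, eval z f ≠ 0 := by
  by_contra! h
  obtain ⟨ν, δ, hν, hmem⟩ := exists_equation_of_finrank_eq_two Pl hPl
  -- a point of the plane
  have hne : (Pl : Set (Fin 3 → K)).Nonempty := by
    rw [AffineSubspace.nonempty_iff_ne_bot]
    intro hbot
    rw [hbot, AffineSubspace.direction_bot, finrank_bot] at hPl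
    omega
  obtain ⟨z₀, hz₀⟩ := hne
  have hδ : ν ⬝ᵥ z₀ = δ := (hmem z₀).1 hz₀
  -- the translate `f(· + z₀)` vanishes on the parallel plane through the origin
  have hvan : ∀ z : Fin 3 → K, ν ⬝ᵥ z = 0 → eval z (translate z₀ f) = 0 := by
    intro z hz
    rw [eval_translate]
    refine h _ ((hmem _).2 ?_)
    rw [dotProduct_add, hz, hδ, zero_add]
  have hirr : Irreducible (translate z₀ f) :=
    (MulEquiv.irreducible_iff (translateEquiv z₀)).2 hf
  have hdvd := linearForm_dvd_of_eval_eq_zero hν _ hvan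
  rcases hirr.dvd_iff.1 hdvd with hu | hassoc
  · exact not_isUnit_linearForm hν hu
  · obtain ⟨u, hu⟩ := hassoc.symm
    obtain ⟨c, -, hc⟩ := MvPolynomial.isUnit_iff_eq_C_of_isReduced.1 (Units.isUnit u)
    have h1 : (translate z₀ f).totalDegree ≤ 1 := by
      rw [← hu, hc]
      refine (totalDegree_mul _ _).trans ?_
      rw [totalDegree_C, add_zero]
      exact (isHomogeneous_linearForm ν).totalDegree_le
    rw [totalDegree_translate] at h1
    omega

end NoPlane

section IrreduciblePlaneSection

variable {K : Type*} [Field K]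

/-- **A plane contains at most `d` lines of an irreducible surface of degree `d ≥ 2`**
(`K` infinite): the count used in Kollár's proof of Prop. 55 ("every other ruling meets `P`
in 2 points, thus is contained in `P`, hence `S = P`"). Combines
`card_lines_in_plane_le_totalDegree` with `exists_mem_eval_ne_zero_of_irreducible`
(an irreducible surface of degree `≥ 2` contains no plane).
[cite: Kollar2015, §7, proof of Prop. 55] -/
theorem card_lines_in_plane_le_of_irreducible [Infinite K] {f : MvPolynomial (Fin 3) K}
    (hf : Irreducible f) (hd : 2 ≤ f.totalDegree) (Pl : AffineSubspace K (Fin 3 → K))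
    (hPl : Module.finrank K Pl.direction = 2) (Λ : Finset (AffineSubspace K (Fin 3 → K)))
    (hΛ1 : ∀ ℓ ∈ Λ, Module.finrank K ℓ.direction = 1) (hΛPl : ∀ ℓ ∈ Λ, ℓ ≤ Pl)
    (hvan : ∀ ℓ ∈ Λ, ∀ z ∈ ℓ, eval z f = 0) : Λ.card ≤ f.totalDegree :=
  card_lines_in_plane_le_totalDegree f Pl hPl (exists_mem_eval_ne_zero_of_irreducible hf hd Pl hPl)
    Λ hΛ1 hΛPl hvan

end IrreduciblePlaneSection

end Literature.Combinatorics.Extremal
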